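import Summits.CriticalPhenomena.Ising3DConformalLimit.Theorems.GapForcesFarMerging.Negative.SoftVerdicts
import Summits.CriticalPhenomena.Ising3DConformalLimit.Theorems.GapForcesFarMerging.Negative.IsingCertificate

/-!
# `EnergyGapSoft` is not decided by the soft package (item stmt-CriticalPhenomena-4473)

Route `EnergyNotSigmaSquared`, support item `EnergyGapSoft`:
`∀ ε > 0, ∃ R, ∀ x, R ≤ ‖x‖ → ⟨σ₀σ_{e₂}σ_xσ_{x+e₂}⟩ - ⟨σ₀σ_{e₂}⟩⟨σ_xσ_{x+e₂}⟩ ≤ ε ⟨σ₀σ_x⟩²` at `β_c` on `ℤ³`.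

The standing disprover of the crux `GapForcesFarMerging` isolated a 22-field **soft package**
(`SoftPackage S T F`, file `GapForcesFarMerging/Negative/SoftShapes.lean`: pair symmetry,
translation and hyperoctahedral invariance, `0 < ⟨σσ⟩ ≤ 1`, the `ℤ³` bounds `c‖x‖⁻² ≤ G ≤ C‖x‖⁻¹`,
Messager–Miracle-Solé, GKS II on pairs, bubble divergence, and for the four-point function
permutation symmetry, `σ² = 1`, GKS I/II, Lebowitz and Aizenman's bound) which the critical Ising
correlators of `ℤ³` provably satisfy up to bubble divergence (`softPackageNoBubble_criticalCorr`), and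
two explicit families `A`, `B` over the kernel `S₀(a,b) = 1/(1+‖b-a‖_∞)` satisfying the whole package
(`softPackage_A`, `softPackage_B`).

Here we read the SOFT-GAP SHAPE of the item — its text with `criticalCorr 3 2 ![a,b] ↦ S a b`,
`criticalTwoPoint 3 ↦ T`, `criticalCorr 3 4 ↦ F` (`energyGapSoft_iff_softGapShape`: for the critical
correlators it is the item verbatim) — on these families:

* `softGapShape_of_gapShape` — the abstract form of "GAP ⟹ EnergyGapSoft"; hence family `A` HAS the
  soft-gap shape (`softGapShape_A`, from the tree's `gapShape_A`);
* `not_softGapShape_of_half`, `not_softGapShape_B` — a Wick deformation with merging parameter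
  `θ ≤ 1/2` on the adjacent quadruples `(0, e₂, n e₁, n e₁ + e₂)` has truncation `≥ T(x)²` there, so
  family `B` does NOT have it;
* **`energyGapSoft_undecided_by_softPackage`** — consequently neither the soft-gap shape nor its
  negation follows from the soft package: no argument using only the 22 catalogued inequalities
  (bubble divergence included) proves or refutes item 4473; a proof must use structure of the model
  beyond them (the geometry of the sourced currents in `energyGapSoft_iff_adjacentMerging`).

Theorems only; no definition, no Theses declaration is asserted.

## References

* J. L. Lebowitz, Comm. Math. Phys. 35 (1974) 87–92 [Lebowitz1974].
* M. Aizenman, Comm. Math. Phys. 86 (1982) 1–48 [AizenmanCMP1982].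
* M. Aizenman, H. Duminil-Copin, Ann. of Math. 194 (2021), §3 [AizenmanDuminilCopinAnnals2021].
-/

noncomputable section

namespace Summit.CriticalPhenomena.Ising3DConformalLimit.EnergyNotSigmaSquaredEnergyGapSoft

open Literature.Probability.LatticeModels
open Summit.CriticalPhenomena.Ising3DConformalLimit.Theses.EnergyNotSigmaSquared
open Summit.CriticalPhenomena.Ising3DConformalLimit.Theorems.GapForcesFarMerging.Negative

/-- `EnergyGapSoft` is literally the soft-gap shape of `(cc2, criticalTwoPoint 3, criticalCorr 3 4)`. [folklore] -/
theorem energyGapSoft_iff_softGapShape :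
    EnergyGapSoft ↔
      ∀ ε : ℝ, 0 < ε → ∃ R : ℝ, ∀ x : Site 3, R ≤ ‖x‖ →
        criticalCorr 3 4 ![0, e₂, x, x + e₂] - cc2 0 e₂ * cc2 x (x + e₂) ≤ ε * criticalTwoPoint 3 x ^ 2 :=
  Iff.rfl

/-- **GAP shape ⟹ soft-gap shape**, for any abstract triple (a power of `‖x‖` is eventually below any
`ε`; only `0 ≤ T(x)²` is used). [folklore] -/
theorem softGapShape_of_gapShape {S : Site 3 → Site 3 → ℝ} {T : Site 3 → ℝ}
    {F : (Fin 4 → Site 3) → ℝ} (h : GapShape S T F) :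
    ∀ ε : ℝ, 0 < ε → ∃ R : ℝ, ∀ x : Site 3, R ≤ ‖x‖ →
      F ![0, e₂, x, x + e₂] - S 0 e₂ * S x (x + e₂) ≤ ε * T x ^ 2 := by
  obtain ⟨κ, C, hκ, hC⟩ := h
  intro ε hε
  set M : ℝ := max C 0 with hM
  have hM0 : 0 ≤ M := le_max_right _ _
  set R : ℝ := max 1 (((M + 1) / ε) ^ (1 / κ)) with hR
  refine ⟨R, fun x hxR => ?_⟩
  have hR1 : (1 : ℝ) ≤ R := le_max_left _ _
  have hxpos : (0 : ℝ) < ‖x‖ := lt_of_lt_of_le one_pos (hR1.trans hxR)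
  have hx0 : x ≠ 0 := by
    intro h0; rw [h0, norm_zero] at hxpos; exact lt_irrefl _ hxpos
  have hT2 : 0 ≤ T x ^ 2 := sq_nonneg _
  have hpow_le : (‖x‖ : ℝ) ^ (-κ) ≤ R ^ (-κ) :=
    Real.rpow_le_rpow_of_nonpos (lt_of_lt_of_le one_pos hR1) hxR (by linarith)
  have hRk : R ^ (-κ) ≤ ε / (M + 1) := by
    have hb : 0 < (M + 1) / ε := by positivity
    have h1 : ((M + 1) / ε) ^ (1 / κ) ≤ R := le_max_right _ _
    have h2 : R ^ (-κ) ≤ (((M + 1) / ε) ^ (1 / κ)) ^ (-κ) :=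
      Real.rpow_le_rpow_of_nonpos (Real.rpow_pos_of_pos hb _) h1 (by linarith)
    refine h2.trans (le_of_eq ?_)
    rw [← Real.rpow_mul hb.le, show (1 / κ) * (-κ) = -1 by field_simp, Real.rpow_neg_one, inv_div]
  calc F ![0, e₂, x, x + e₂] - S 0 e₂ * S x (x + e₂)
      ≤ C * (‖x‖ : ℝ) ^ (-κ) * T x ^ 2 := hC x hx0
    _ ≤ M * (‖x‖ : ℝ) ^ (-κ) * T x ^ 2 :=
        mul_le_mul_of_nonneg_right
          (mul_le_mul_of_nonneg_right (le_max_left _ _) (Real.rpow_nonneg (norm_nonneg _) _)) hT2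
    _ ≤ M * (R ^ (-κ)) * T x ^ 2 := by gcongr
    _ ≤ M * (ε / (M + 1)) * T x ^ 2 := by gcongr
    _ ≤ ε * T x ^ 2 := by
        apply mul_le_mul_of_nonneg_right _ hT2
        rw [mul_div_assoc', div_le_iff₀ (by positivity)]
        nlinarith

/-- **Family A has the soft-gap shape** (it even has the GAP shape, `gapShape_A`). [folklore] -/
theorem softGapShape_A :
    ∀ ε : ℝ, 0 < ε → ∃ R : ℝ, ∀ x : Site 3, R ≤ ‖x‖ →
      FA ![0, e₂, x, x + e₂] - S₀ 0 e₂ * S₀ x (x + e₂) ≤ ε * T₀ x ^ 2 :=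
  softGapShape_of_gapShape gapShape_A

/-- A Wick deformation with `θ ≤ 1/2` on the adjacent quadruples at `x = n e₁` violates the soft-gap
shape: there the truncation is `≥ g(x)² = T₀(x)²`, not `o(T₀(x)²)`. [folklore] -/
theorem not_softGapShape_of_half {θ : (Fin 4 → Site 3) → ℝ} (hθ0 : ∀ y, 0 ≤ θ y)
    (hhalf : ∀ n : ℕ, 2 ≤ n → θ ![0, e₂, (n : ℤ) • e₁, (n : ℤ) • e₁ + e₂] ≤ 1 / 2) :
    ¬ ∀ ε : ℝ, 0 < ε → ∃ R : ℝ, ∀ x : Site 3, R ≤ ‖x‖ →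
      Fθ θ ![0, e₂, x, x + e₂] - S₀ 0 e₂ * S₀ x (x + e₂) ≤ ε * T₀ x ^ 2 := by
  intro h
  obtain ⟨R, hR⟩ := h (1 / 2) (by norm_num)
  -- pick `n ≥ 2` with `R ≤ n`
  obtain ⟨n, hn⟩ := exists_nat_gt (max 2 R)
  have h2 : (2 : ℝ) < n := lt_of_le_of_lt (le_max_left _ _) hn
  have hn2 : 2 ≤ n := by exact_mod_cast h2.le
  have hRn : R ≤ n := ((le_max_right _ _).trans hn.le)
  set x : Site 3 := (n : ℤ) • e₁ with hx_def
  have hxnorm : ‖x‖ = n := by rw [hx_def, norm_smul, norm_e₁]; simp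
  have hmain := hR x (by rw [hxnorm]; exact hRn)
  rw [adjacent_trunc_eq, pmin_adjacent_eq] at hmain
  have hT : T₀ x = g x := by simp [T₀, S₀]
  rw [hT] at hmain
  have hθ := hhalf n hn2
  have hθ0' := hθ0 ![0, e₂, (n : ℤ) • e₁, (n : ℤ) • e₁ + e₂]
  have hminle : min (min (g e₂ * g e₂) (g x * g x)) (g (x + e₂) * g (x - e₂)) ≤ g (x + e₂) * g (x - e₂) :=
    min_le_right _ _
  have hmin0 : 0 ≤ min (min (g e₂ * g e₂) (g x * g x)) (g (x + e₂) * g (x - e₂)) :=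
    le_min (le_min (mul_nonneg (g_pos _).le (g_pos _).le) (mul_nonneg (g_pos _).le (g_pos _).le))
      (mul_nonneg (g_pos _).le (g_pos _).le)
  have hgx : 0 < g x := g_pos x
  -- `g x² ≤ truncation ≤ g x² / 2`
  have h1 : g x * g x ≤ 1 / 2 * g x ^ 2 := by
    nlinarith [mul_nonneg hmin0 hθ0', mul_nonneg (mul_nonneg (g_pos (x + e₂)).le (g_pos (x - e₂)).le) hθ0']
  nlinarith [mul_pos hgx hgx]

/-- **Family B does not have the soft-gap shape.** [folklore] -/
theorem not_softGapShape_B :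
    ¬ ∀ ε : ℝ, 0 < ε → ∃ R : ℝ, ∀ x : Site 3, R ≤ ‖x‖ →
      FB ![0, e₂, x, x + e₂] - S₀ 0 e₂ * S₀ x (x + e₂) ≤ ε * T₀ x ^ 2 :=
  not_softGapShape_of_half thetaHyp_B.nonneg fun n hn => by
    unfold θB
    rw [sep_adjacent_eq_one n (by omega)]
    norm_num

/-- **`EnergyGapSoft` is undecided by the soft package**: there are triples satisfying all 22 fields of
`SoftPackage` WITH the soft-gap shape (family A) and WITHOUT it (family B). Since the critical Ising
correlators of `ℤ³` satisfy the package (`softPackageNoBubble_criticalCorr`, plus bubble divergence),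
neither item 4473 nor its negation is a consequence of these inequalities alone. [folklore] -/
theorem energyGapSoft_undecided_by_softPackage :
    (∃ (S : Site 3 → Site 3 → ℝ) (T : Site 3 → ℝ) (F : (Fin 4 → Site 3) → ℝ),
        SoftPackage S T F ∧
          ∀ ε : ℝ, 0 < ε → ∃ R : ℝ, ∀ x : Site 3, R ≤ ‖x‖ →
            F ![0, e₂, x, x + e₂] - S 0 e₂ * S x (x + e₂) ≤ ε * T x ^ 2) ∧
      ∃ (S : Site 3 → Site 3 → ℝ) (T : Site 3 → ℝ) (F : (Fin 4 → Site 3) → ℝ),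
        SoftPackage S T F ∧
          ¬ ∀ ε : ℝ, 0 < ε → ∃ R : ℝ, ∀ x : Site 3, R ≤ ‖x‖ →
            F ![0, e₂, x, x + e₂] - S 0 e₂ * S x (x + e₂) ≤ ε * T x ^ 2 :=
  ⟨⟨S₀, T₀, FA, softPackage_A, softGapShape_A⟩, ⟨S₀, T₀, FB, softPackage_B, not_softGapShape_B⟩⟩

/-- Family A also shows that the soft-gap shape is consistent with the package together with the
FAILURE of far merging (`not_farMergingShape_A`): even granted item 4473, the soft package does not
force the conclusion of the crux `GapForcesFarMerging`. [folklore] -/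
theorem softGapShape_and_not_farMerging_consistent :
    ∃ (S : Site 3 → Site 3 → ℝ) (T : Site 3 → ℝ) (F : (Fin 4 → Site 3) → ℝ),
      SoftPackage S T F ∧
        (∀ ε : ℝ, 0 < ε → ∃ R : ℝ, ∀ x : Site 3, R ≤ ‖x‖ →
          F ![0, e₂, x, x + e₂] - S 0 e₂ * S x (x + e₂) ≤ ε * T x ^ 2) ∧
        ¬ FarMergingShape S F :=
  ⟨S₀, T₀, FA, softPackage_A, softGapShape_A, not_farMergingShape_A⟩

end Summit.CriticalPhenomena.Ising3DConformalLimit.EnergyNotSigmaSquaredEnergyGapSoft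

end
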